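import Mathlib
import Summits.KontsevichZagierPeriods.KontsevichZagierPeriods.Theorems.InverseLandauTateFamilyKernelRationalCertificate
import Summits.KontsevichZagierPeriods.KontsevichZagierPeriods.Theorems.InverseLandauTateFamilyKernelGapInstance

/-!
# `TateFamilyKernel` — a vanishing element that is NOT Griffiths-exact is certified by a cube symmetry (line `Sketch`, stub `stub_oddInstance`)

Crux `TateFamilyKernel` (stmt-KontsevichZagierPeriods-9130, route `InverseLandau`), line `Sketch`, kind (d) of the
descent normal form (`Cruxes/TateFamilyKernel/Lines/Sketch.md`). For the swap-symmetric cubic pencil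
`Q = 1 − ϖ(1 + z₁z₂(z₁ + z₂))` (Tate; admissible on `(0, 1/3)`) the numerator `P = z₁ − z₂` has identically
vanishing open-square integrals (the integrand is odd under `z₁ ↔ z₂`), and the lead's exact test
(`exp/dnf_local.py`) shows that `P/Q dz₁dz₂` is NOT `∂₁(A₁/Qᵏ) + ∂₂(A₂/Qᵏ)` for any polynomials `Aᵢ` with
`k ≤ 5` — the de Rham route of `stub_gapInstance` is closed here. Kind (d) settles it in one move: with
`h = P/(2Q)` the fibre is `h − h ∘ swap` on the closed square, a change of variables of the cube (rule (2),
landed as `tame_sub_comp_equiv_mem_relations`, p111536). [cite: KontsevichZagier2001, §1.2 rule (2)]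
-/

noncomputable section

open MeasureTheory Set MvPolynomial
open Literature.NumberTheory.Transcendental
open Literature.ModelTheory.ExponentialFields (IsSemialgebraic)

namespace Summit.KontsevichZagierPeriods.InverseLandau.TateFamilyKernel.Descent.Odd

/-- Value of the numerator `z₁ − z₂`. [folklore] -/
theorem evalP (v : Fin (2 + 1) → ℝ) :
    aeval v ((X 0 - X 1 : MvPolynomial (Fin (2 + 1)) ℚ)) = v 0 - v 1 := by
  simp

/-- Value of the denominator `1 − ϖ − ϖ z₁z₂(z₁+z₂)`. [folklore] -/
theorem evalQ (v : Fin (2 + 1) → ℝ) :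
    aeval v ((1 - X 2 - X 2 * X 0 * X 1 * (X 0 + X 1) : MvPolynomial (Fin (2 + 1)) ℚ)) =
      1 - v 2 - v 2 * v 0 * v 1 * (v 0 + v 1) := by
  simp

/-- Value of `2Q`. [folklore] -/
theorem eval2Q (v : Fin (2 + 1) → ℝ) :
    aeval v ((C 2 * (1 - X 2 - X 2 * X 0 * X 1 * (X 0 + X 1)) : MvPolynomial (Fin (2 + 1)) ℚ)) =
      2 * (1 - v 2 - v 2 * v 0 * v 1 * (v 0 + v 1)) := by
  simp

/-- `Q ≥ 1 − 3ϖ > 0` on the closed square for `0 < ϖ`, `3ϖ < 1`. [folklore] -/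
theorem Q_pos {p a b : ℝ} (h0 : 0 < p) (h1 : 3 * p < 1) (ha : 0 ≤ a ∧ a ≤ 1) (hb : 0 ≤ b ∧ b ≤ 1) :
    0 < 1 - p - p * a * b * (a + b) := by
  have hab : 0 ≤ a * b := mul_nonneg ha.1 hb.1
  have hab1 : a * b ≤ 1 := mul_le_one₀ ha.2 hb.1 hb.2
  have hs : a + b ≤ 2 := by linarith [ha.2, hb.2]
  have : p * a * b * (a + b) ≤ 2 * p := by
    have := mul_le_mul hab1 hs (by linarith [ha.1, hb.1]) zero_le_one
    nlinarith [mul_nonneg h0.le (mul_nonneg hab (by linarith [ha.1, hb.1] : (0:ℝ) ≤ a + b))]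
  linarith

/-- The odd/even identity `F = F/2 − (F∘swap)/2` for `F = (a − b)/Q(a,b)`, `Q` symmetric. [folklore] -/
theorem odd_identity (a b p : ℝ) (hQ : 1 - p - p * a * b * (a + b) ≠ 0) :
    (a - b) / (1 - p - p * a * b * (a + b)) =
      (a - b) / (2 * (1 - p - p * a * b * (a + b))) - (b - a) / (2 * (1 - p - p * b * a * (b + a))) := by
  have h' : 1 - p - p * b * a * (b + a) = 1 - p - p * a * b * (a + b) := by ring
  have hD : 2 * (1 - p - p * a * b * (a + b)) ≠ 0 := mul_ne_zero two_ne_zero hQ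
  rw [h', div_sub_div _ _ hD hD, div_eq_div_iff hQ (mul_ne_zero hD hD)]
  ring

end Odd

open Odd in
/-- STUB `stub_oddInstance` of line `Sketch` — **a non-exact vanishing element certified by kind (d).** For
real-algebraic `ϖ₀` with `0 < ϖ₀`, `3ϖ₀ < 1` (the admissible range of `Q = 1 − ϖ(1 + z₁z₂(z₁+z₂))`), every
tame cube representation of the fibre `(z₁ − z₂)/Q(·,ϖ₀)` on `[0,1]²` lies in `KZ.relations`: it is
`h − h ∘ swap` for the tame `h = (z₁ − z₂)/(2Q)` (one rule-(2) move, `tame_sub_comp_equiv_mem_relations`).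
[cite: KontsevichZagier2001, §1.2 rule (2)] -/
theorem stub_oddInstance :
    ∀ (ϖ₀ : ℝ), IsAlgebraic ℚ ϖ₀ → 0 < ϖ₀ → 3 * ϖ₀ < 1 →
      ∀ Φ : KZ.IntegralRep 2, Φ.IsTameCube →
        (∀ z ∈ KZ.cube 2, Φ.integrand z =
          aeval (Fin.snoc z ϖ₀ : Fin (2 + 1) → ℝ) ((X 0 - X 1) : MvPolynomial (Fin (2 + 1)) ℚ) /
            aeval (Fin.snoc z ϖ₀ : Fin (2 + 1) → ℝ) ((1 - X 2 - X 2 * X 0 * X 1 * (X 0 + X 1)) : MvPolynomial (Fin (2 + 1)) ℚ)) →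
        KZ.of Φ ∈ KZ.relations := by
  intro ϖ₀ halg h0 h1 Φ hΦ hΦi
  have h2Q : ∀ z ∈ KZ.cube 2, aeval (Fin.snoc z ϖ₀ : Fin (2 + 1) → ℝ)
      ((C 2 * (1 - X 2 - X 2 * X 0 * X 1 * (X 0 + X 1))) : MvPolynomial (Fin (2 + 1)) ℚ) ≠ 0 := by
    intro z hz
    rw [eval2Q, Gap.snoc3_0, Gap.snoc3_1, Gap.snoc3_2]
    exact mul_ne_zero two_ne_zero (Q_pos h0 h1 (KZ.mem_cube.1 hz 0) (KZ.mem_cube.1 hz 1)).ne'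
  have hha := analyticOnNhd_slice ((X 0 - X 1) : MvPolynomial (Fin (2 + 1)) ℚ)
    ((C 2 * (1 - X 2 - X 2 * X 0 * X 1 * (X 0 + X 1))) : MvPolynomial (Fin (2 + 1)) ℚ) ϖ₀ h2Q
  have hhs := isSemialgebraicFunOn_slice ((X 0 - X 1) : MvPolynomial (Fin (2 + 1)) ℚ)
    ((C 2 * (1 - X 2 - X 2 * X 0 * X 1 * (X 0 + X 1))) : MvPolynomial (Fin (2 + 1)) ℚ) halg h2Q
  refine tame_sub_comp_equiv_mem_relations (Equiv.swap (0 : Fin 2) 1) hha hhs Φ hΦ (fun z hz => ?_)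
  have hQz := (Q_pos h0 h1 (KZ.mem_cube.1 hz 0) (KZ.mem_cube.1 hz 1)).ne'
  rw [hΦi z hz]
  simp only [evalP, evalQ, eval2Q, Gap.snoc3_0, Gap.snoc3_1, Gap.snoc3_2, Equiv.swap_apply_left,
    Equiv.swap_apply_right]
  exact odd_identity (z 0) (z 1) ϖ₀ hQz

end Summit.KontsevichZagierPeriods.InverseLandau.TateFamilyKernel.Descent
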